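import Literature.AlgebraicGeometry.HodgeTheory.HyperplaneClassRestrictionNonzero
import Literature.AlgebraicGeometry.HodgeTheory.HolomorphicBundleChernCharacterProjectiveSpace
import Literature.AlgebraicGeometry.HodgeTheory.AffineLineBundleCohomology
import Literature.AlgebraicGeometry.Motives.AlgebraicEquivalenceFibreDimension
import HarnessLib

/-!
# A Zariski-locally trivial `ℙʳ`-bundle on complex points: fibres and trivialisations

Family `hodge`, layer `Literature/AlgebraicGeometry/HodgeTheory`. Theorem-only file (no definition,
no named fact), the `ℙʳ`-analogue of the `𝔸¹`-trivialisations of `AffineLineBundleCohomology`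
(C. Voisin, *Hodge Theory and Complex Algebraic Geometry I*, Lemma 7.32: the cohomology of a
projective bundle, whose topological input is the local triviality of `E(ℂ) → X(ℂ)` and the
non-vanishing of the hyperplane class on the fibres). Let `q : E ⟶ X` be a `ℂ`-morphism and
`U ⊆ X` an open over which `q⁻¹U ≅ U ⊗ ℙʳ_ℂ` over `U` (an isomorphism `φ` of `ℂ`-schemes commuting
with the maps to `U`). Then:

* `ZariskiProjectiveBundle.isClosedImmersion_fibre_left` — for a complex point `b'` of `U`, the
  fibre embedding `ℙʳ ≅ {b'} × ℙʳ ⟶ U ⊗ ℙʳ ≅ q⁻¹U ↪ E` is a CLOSED immersion (the pasted square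
  `ℙʳ → E` over `Spec ℂ → X` is cartesian — product square, isomorphism, restriction square
  `q⁻¹U → E` over `U → X` — and `Spec ℂ → X` is a closed immersion, `X` being locally of finite
  type; Hartshorne II Ex. 3.10);
* `ZariskiProjectiveBundle.exists_trivialisation` — the topological trivialisation
  `q(ℂ)⁻¹(U(ℂ)) ≃ U(ℂ) × ℙ(ℂ^{r+1})` over `U(ℂ)` of the map on complex points (complex points
  commute with open subschemes, isomorphisms and products, SGA1 XII / Serre GAGA §2; Serre's
  `ℙʳ_ℂ(ℂ) ≃ₜ ℙ(ℂ^{r+1})`, `isHomeomorph_projPoint`), whose inverse on each fibre is given by the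
  complex points of the (closed) fibre embedding;
* `ZariskiProjectiveBundle.map_two_ne_zero_of_isClosedImmersion` — **a non-zero class of
  `H²(ℙᴺ(ℂ); ℂ)` restricts non-trivially along every closed immersion `ℙʳ ↪ E`** through any
  closed immersion `E ↪ ℙᴺ` (`r ≥ 1`): `ℙʳ ↪ ℙᴺ` is a positive-dimensional smooth closed subvariety
  (Voisin I §3.3.2, the tree's `complexBetti_map_two_ne_zero_of_isClosedImmersion`).

## References

* [SerreGAGA1956] J.-P. Serre, GAGA, Ann. Inst. Fourier 6 (1956), §2 n°5.
* [VoisinHodgeI2002] C. Voisin, Hodge Theory and Complex Algebraic Geometry I, CUP 2002, §3.3.2,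
  §7.3.3 Lemma 7.32.
* [Hartshorne1977] R. Hartshorne, Algebraic Geometry, GTM 52, II.3 Thm. 3.3, II Ex. 3.10.
-/

noncomputable section

open CategoryTheory AlgebraicGeometry MonoidalCategory CartesianMonoidalCategory
  Literature.AlgebraicGeometry Literature.AlgebraicGeometry.Motives Literature.NumberTheory.Transcendental
open scoped LinearAlgebra.Projectivization

namespace Literature.AlgebraicGeometry.HodgeTheory

namespace ZariskiProjectiveBundle

/-! ### `Spec ℂ` over `Spec ℂ` -/

/-- An endomorphism of `Spec ℂ` over `Spec ℂ` is the identity. [folklore] -/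
theorem endo_specOver_eq_id (s : specOver ℂ ℂ ⟶ specOver ℂ ℂ) : s = 𝟙 _ := by
  ext1
  have h := Over.w s
  have hid : (specOver ℂ ℂ).hom = 𝟙 (Spec (.of ℂ)) := by
    change Spec.map (CommRingCat.ofHom (algebraMap ℂ ℂ)) = _
    rw [Algebra.algebraMap_self, CommRingCat.ofHom_id, Spec.map_id]
  rw [hid] at h
  rw [Over.id_left]
  exact (Category.comp_id _).symm.trans h

/-! ### The fibre embedding `ℙʳ ⟶ E` at a complex point of `U` -/

section Fibre

variable {X E : SchemeOver ℂ} {q : E ⟶ X} {U : X.left.Opens} {r : ℕ}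
  (φ : openSubschemeOver E (q.left ⁻¹ᵁ U) ≅ openSubschemeOver X U ⊗ Motives.projectiveSpace r ℂ)

/-- On complex points the fibre embedding `ℙʳ ≅ {b'} × ℙʳ ⟶ U ⊗ ℙʳ ≅ q⁻¹U ↪ E` is
`v ↦ φ⁻¹(b', v)`. [folklore] -/
theorem map_fibre (b' : ComplexPoints (openSubschemeOver X U))
    (v : ComplexPoints (Motives.projectiveSpace r ℂ)) :
    AlgPoints.map (lift (toSpecOver (Motives.projectiveSpace r ℂ) ≫ b') (𝟙 _) ≫ φ.inv ≫
        openSubschemeOverι E (q.left ⁻¹ᵁ U)) v =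
      AlgPoints.map (openSubschemeOverι E (q.left ⁻¹ᵁ U))
        (AlgPoints.map φ.inv (AlgPoints.prodEquiv.symm (b', v))) := by
  simp only [AlgPoints.map_apply, AlgPoints.prodEquiv_symm_apply]
  have hv : v ≫ toSpecOver (Motives.projectiveSpace r ℂ) = 𝟙 _ := endo_specOver_eq_id _
  rw [← Category.assoc v, comp_lift, ← Category.assoc v, hv, Category.id_comp, Category.comp_id,
    Category.assoc]

/-- `φ ≫ pr_U = q|_U` as `ℂ`-morphisms `q⁻¹U ⟶ U`. [folklore] -/
theorem hom_fst_eq (hφ : φ.hom.left ≫ (fst (openSubschemeOver X U) (Motives.projectiveSpace r ℂ)).left ≫ U.ι =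
      (q.left ⁻¹ᵁ U).ι ≫ q.left) :
    φ.hom ≫ fst (openSubschemeOver X U) (Motives.projectiveSpace r ℂ) = restrictOverHom q U := by
  ext1
  rw [Over.comp_left, restrictOverHom_left]
  exact (cancel_mono U.ι).mp ((Category.assoc _ _ _).trans (hφ.trans (morphismRestrict_ι _ _).symm))

/-- `φ⁻¹ ≫ q|_U = pr_U` as `ℂ`-morphisms `U ⊗ ℙʳ ⟶ U`. [folklore] -/
theorem inv_restrictOverHom_eq (hφ : φ.hom.left ≫ (fst (openSubschemeOver X U) (Motives.projectiveSpace r ℂ)).left ≫ U.ι =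
      (q.left ⁻¹ᵁ U).ι ≫ q.left) :
    φ.inv ≫ restrictOverHom q U = fst (openSubschemeOver X U) (Motives.projectiveSpace r ℂ) := by
  rw [← hom_fst_eq φ hφ, Iso.inv_hom_id_assoc]

/-- `φ ≫ pr_U ≫ (U ↪ X) = (q⁻¹U ↪ E) ≫ q` as `ℂ`-morphisms. [folklore] -/
theorem hom_fst_ι (hφ : φ.hom.left ≫ (fst (openSubschemeOver X U) (Motives.projectiveSpace r ℂ)).left ≫ U.ι =
      (q.left ⁻¹ᵁ U).ι ≫ q.left) :
    φ.hom ≫ fst _ _ ≫ openSubschemeOverι X U = openSubschemeOverι E (q.left ⁻¹ᵁ U) ≫ q := by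
  rw [← Category.assoc, hom_fst_eq φ hφ, restrictOverHom_comp_openSubschemeOverι]

/-- The product square `ℙʳ → U ⊗ ℙʳ` over `Spec ℂ → U` at a complex point of `U` is cartesian
(as for the tree's `isPullback_sliceAt`, with the factors in the other order). [folklore] -/
theorem isPullback_lift_left (b' : ComplexPoints (openSubschemeOver X U)) :
    IsPullback (lift (toSpecOver (Motives.projectiveSpace r ℂ) ≫ b') (𝟙 (Motives.projectiveSpace r ℂ))).left
      (Motives.projectiveSpace r ℂ).hom
      (fst (openSubschemeOver X U) (Motives.projectiveSpace r ℂ)).left b'.toSpecHom := by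
  have hR : IsPullback (snd (openSubschemeOver X U) (Motives.projectiveSpace r ℂ)).left
      (fst (openSubschemeOver X U) (Motives.projectiveSpace r ℂ)).left (Motives.projectiveSpace r ℂ).hom
      (openSubschemeOver X U).hom :=
    (IsPullback.of_hasPullback (openSubschemeOver X U).hom (Motives.projectiveSpace r ℂ).hom).flip
  have h1 : (lift (toSpecOver (Motives.projectiveSpace r ℂ) ≫ b') (𝟙 (Motives.projectiveSpace r ℂ))).left ≫
      (snd (openSubschemeOver X U) (Motives.projectiveSpace r ℂ)).left = 𝟙 (Motives.projectiveSpace r ℂ).left := by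
    rw [← Over.comp_left, lift_snd]
    rfl
  have h2 : b'.toSpecHom ≫ (openSubschemeOver X U).hom = 𝟙 (Spec (.of ℂ)) := by
    change b'.left ≫ (openSubschemeOver X U).hom = _
    rw [Over.w b']
    change Spec.map (CommRingCat.ofHom (algebraMap ℂ ℂ)) = _
    rw [Algebra.algebraMap_self, CommRingCat.ofHom_id, Spec.map_id]
  refine IsPullback.of_right ?_ ?_ hR
  · haveI : IsIso ((lift (toSpecOver (Motives.projectiveSpace r ℂ) ≫ b') (𝟙 (Motives.projectiveSpace r ℂ))).left ≫
        (snd (openSubschemeOver X U) (Motives.projectiveSpace r ℂ)).left) := h1 ▸ inferInstance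
    haveI : IsIso (b'.toSpecHom ≫ (openSubschemeOver X U).hom) := h2 ▸ inferInstance
    exact IsPullback.of_horiz_isIso ⟨by rw [h1, h2, Category.id_comp, Category.comp_id]⟩
  · rw [← Over.comp_left, lift_fst]
    rfl

/-- **The fibre embedding is a closed immersion** (`X` locally of finite type over `ℂ`): the pasted
square `ℙʳ → U ⊗ ℙʳ ≅ q⁻¹U → E` over `Spec ℂ → U = U → X` is cartesian and the complex point
`Spec ℂ → X` is a closed immersion. [cite: Hartshorne1977, II Ex. 3.10 and II.4 (closed immersions are stable under base change)] -/
theorem isClosedImmersion_fibre_left [LocallyOfFiniteType X.hom]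
    (hφ : φ.hom.left ≫ (fst (openSubschemeOver X U) (Motives.projectiveSpace r ℂ)).left ≫ U.ι =
      (q.left ⁻¹ᵁ U).ι ≫ q.left)
    (b' : ComplexPoints (openSubschemeOver X U)) :
    IsClosedImmersion (lift (toSpecOver (Motives.projectiveSpace r ℂ) ≫ b') (𝟙 _) ≫ φ.inv ≫
      openSubschemeOverι E (q.left ⁻¹ᵁ U)).left := by
  -- (1) the product square `ℙʳ → U ⊗ ℙʳ` over `Spec ℂ → U`
  have sq1 := isPullback_lift_left (r := r) b'
  -- (2) the isomorphism square `U ⊗ ℙʳ ≅ q⁻¹U` over `U = U`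
  haveI : IsIso φ.inv.left := (inferInstance : IsIso ((Over.forget _).map φ.inv))
  have sq2 : IsPullback φ.inv.left (fst (openSubschemeOver X U) (Motives.projectiveSpace r ℂ)).left
      (restrictOverHom q U).left (𝟙 (openSubschemeOver X U).left) :=
    IsPullback.of_horiz_isIso ⟨by rw [← Over.comp_left, inv_restrictOverHom_eq φ hφ, Category.comp_id]⟩
  -- (3) the restriction square `q⁻¹U → E` over `U → X`
  have sq3 : IsPullback (openSubschemeOverι E (q.left ⁻¹ᵁ U)).left (restrictOverHom q U).left q.left U.ι :=
    (isPullback_morphismRestrict q.left U).flip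
  have sq := (sq1.paste_horiz sq2).paste_horiz sq3
  -- the bottom composite is the complex point `Spec ℂ → U → X`, a closed immersion
  have hb : IsClosedImmersion ((b'.toSpecHom ≫ 𝟙 (openSubschemeOver X U).left) ≫ U.ι) := by
    rw [Category.comp_id]
    exact AlgPoints.isClosedImmersion_toSpecHom X (AlgPoints.map (openSubschemeOverι X U) b')
  rw [Over.comp_left, Over.comp_left, ← Category.assoc]
  exact MorphismProperty.of_isPullback sq.flip hb

omit φ in
/-- **A non-zero class of `H²(ℙᴺ(ℂ); ℂ)` restricts non-trivially along a closed immersion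
`ι : ℙʳ ↪ E`** through any closed immersion `E ↪ ℙᴺ`, when `r ≥ 1`: `ℙʳ ↪ E ↪ ℙᴺ` is a smooth
closed subvariety of positive dimension (Voisin I §3.3.2: the hyperplane class restricts to the
Kähler class; the tree's `complexBetti_map_two_ne_zero_of_isClosedImmersion`).
[cite: VoisinHodgeI2002, §3.3.2 Lemma 3.16 and the remark following it] -/
theorem map_two_ne_zero_of_isClosedImmersion (hr : 1 ≤ r) {N : ℕ}
    (emb : E ⟶ Motives.projectiveSpace N ℂ) [IsClosedImmersion emb.left]
    {h : complexBetti (Motives.projectiveSpace N ℂ) 2} (hh : h ≠ 0)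
    (ι : Motives.projectiveSpace r ℂ ⟶ E) [IsClosedImmersion ι.left] :
    complexBetti.map ι 2 (complexBetti.map emb 2 h) ≠ 0 := by
  haveI : IsClosedImmersion (ι ≫ emb).left := by
    rw [Over.comp_left]
    infer_instance
  have key := complexBetti_map_two_ne_zero_of_isClosedImmersion
    (isSmoothProjective_projectiveSpace' r) hr (ι ≫ emb) hh
  rwa [complexBetti.map_comp] at key

end Fibre

/-! ### The trivialisation on complex points -/

section Triv

variable {X E : SchemeOver ℂ} {q : E ⟶ X} {U : X.left.Opens} {r : ℕ}
  (φ : openSubschemeOver E (q.left ⁻¹ᵁ U) ≅ openSubschemeOver X U ⊗ Motives.projectiveSpace r ℂ)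

omit φ in
/-- `q(ℂ)⁻¹(U(ℂ)) = (q⁻¹U)(ℂ)` as subsets of `E(ℂ)` (`rfl` pointwise). [folklore] -/
theorem preimage_setOf_pt_mem (q : E ⟶ X) (U : X.left.Opens) :
    (AlgPoints.mapContinuous (L := ℂ) q) ⁻¹' {P : ComplexPoints X | P.pt ∈ U} =
      {P' : ComplexPoints E | P'.pt ∈ q.left ⁻¹ᵁ U} := by
  ext P'
  rfl

/-- **The topological trivialisation** `q(ℂ)⁻¹(U(ℂ)) ≃ₜ U(ℂ) × ℙ(ℂ^{r+1})` over `U(ℂ)` induced by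
`φ : q⁻¹U ≅ U ⊗ ℙʳ` — complex points of open subschemes (`AlgPoints.isOpenEmbedding_map_holds`),
of an isomorphism, of a product (`AlgPoints.isHomeomorph_prodEquiv_holds`), and Serre's
`ℙʳ_ℂ(ℂ) ≃ₜ ℙ(ℂ^{r+1})` (`isHomeomorph_projPoint`) — whose inverse on each fibre `{b} × ℙ(ℂ^{r+1})`
is, on complex points, a CLOSED immersion `ℙʳ ⟶ E` of `ℂ`-schemes (the fibre embedding at `b`,
`isClosedImmersion_fibre_left`) composed with a fixed homeomorphism `ℙ(ℂ^{r+1}) ≃ₜ ℙʳ_ℂ(ℂ)`.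
[cite: SerreGAGA1956, §2 n°5] -/
theorem exists_trivialisation [LocallyOfFiniteType X.hom]
    (hφ : φ.hom.left ≫ (fst (openSubschemeOver X U) (Motives.projectiveSpace r ℂ)).left ≫ U.ι =
      (q.left ⁻¹ᵁ U).ι ≫ q.left) :
    ∃ T : ↥((AlgPoints.mapContinuous (L := ℂ) q) ⁻¹' {P : ComplexPoints X | P.pt ∈ U}) ≃ₜ
        ↥{P : ComplexPoints X | P.pt ∈ U} × ℙ ℂ (Fin (r + 1) → ℂ),
      (∀ x, ((T x).1 : ComplexPoints X) = AlgPoints.mapContinuous (L := ℂ) q x) ∧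
      ∃ η : ℙ ℂ (Fin (r + 1) → ℂ) ≃ₜ ComplexPoints (Motives.projectiveSpace r ℂ),
        ∀ b : ↥{P : ComplexPoints X | P.pt ∈ U}, ∃ ι : Motives.projectiveSpace r ℂ ⟶ E,
          IsClosedImmersion ι.left ∧
          ∀ v, ((T.symm (b, v) : ↥((AlgPoints.mapContinuous (L := ℂ) q) ⁻¹' {P : ComplexPoints X | P.pt ∈ U})) :
            ComplexPoints E) = AlgPoints.map ι (η v) := by
  -- complex points of the open subschemes `q⁻¹U ⊆ E`, `U ⊆ X`
  have hrE := range_map_openSubschemeOverι E (q.left ⁻¹ᵁ U)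
  have hrX := range_map_openSubschemeOverι X U
  haveI := isOpenImmersion_openSubschemeOverι_left E (q.left ⁻¹ᵁ U)
  haveI := isOpenImmersion_openSubschemeOverι_left X U
  let θO : ComplexPoints (openSubschemeOver E (q.left ⁻¹ᵁ U)) ≃ₜ
      ↥((AlgPoints.mapContinuous (L := ℂ) q) ⁻¹' {P : ComplexPoints X | P.pt ∈ U}) :=
    ((AlgPoints.isOpenEmbedding_map_holds (L := ℂ) (openSubschemeOverι E (q.left ⁻¹ᵁ U))).isEmbedding.toHomeomorph.trans
      (Homeomorph.setCongr hrE)).trans (Homeomorph.setCongr (preimage_setOf_pt_mem q U).symm)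
  have hθO : ∀ Q, ((θO Q : ↥((AlgPoints.mapContinuous (L := ℂ) q) ⁻¹' _)) : ComplexPoints E) =
      AlgPoints.map (openSubschemeOverι E (q.left ⁻¹ᵁ U)) Q := fun _ ↦ rfl
  let θV : ComplexPoints (openSubschemeOver X U) ≃ₜ ↥{P : ComplexPoints X | P.pt ∈ U} :=
    (AlgPoints.isOpenEmbedding_map_holds (L := ℂ) (openSubschemeOverι X U)).isEmbedding.toHomeomorph.trans
      (Homeomorph.setCongr hrX)
  have hθV : ∀ Q, ((θV Q : ↥{P : ComplexPoints X | P.pt ∈ U}) : ComplexPoints X) =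
      AlgPoints.map (openSubschemeOverι X U) Q := fun _ ↦ rfl
  -- complex points along `φ`, of the product, and of `ℙʳ`
  let θε : ComplexPoints (openSubschemeOver E (q.left ⁻¹ᵁ U)) ≃ₜ
      ComplexPoints (openSubschemeOver X U ⊗ Motives.projectiveSpace r ℂ) :=
    { toFun := AlgPoints.map φ.hom
      invFun := AlgPoints.map φ.inv
      left_inv := fun Q ↦ by
        change AlgPoints.map φ.inv (AlgPoints.map φ.hom Q) = Q
        rw [← AlgPoints.map_comp_apply, φ.hom_inv_id, AlgPoints.map_id_apply]
      right_inv := fun Q ↦ by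
        change AlgPoints.map φ.hom (AlgPoints.map φ.inv Q) = Q
        rw [← AlgPoints.map_comp_apply, φ.inv_hom_id, AlgPoints.map_id_apply]
      continuous_toFun := AlgPoints.continuous_map φ.hom
      continuous_invFun := AlgPoints.continuous_map φ.inv }
  let θP : ComplexPoints (openSubschemeOver X U ⊗ Motives.projectiveSpace r ℂ) ≃ₜ
      ComplexPoints (openSubschemeOver X U) × ComplexPoints (Motives.projectiveSpace r ℂ) :=
    { toEquiv := AlgPoints.prodEquiv
      continuous_toFun := AlgPoints.continuous_prodEquiv
      continuous_invFun := AlgPoints.continuous_prodEquiv_symm }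
  let η : ℙ ℂ (Fin (r + 1) → ℂ) ≃ₜ ComplexPoints (Motives.projectiveSpace r ℂ) :=
    (isHomeomorph_projPoint r).homeomorph
  let T : ↥((AlgPoints.mapContinuous (L := ℂ) q) ⁻¹' {P : ComplexPoints X | P.pt ∈ U}) ≃ₜ
      ↥{P : ComplexPoints X | P.pt ∈ U} × ℙ ℂ (Fin (r + 1) → ℂ) :=
    θO.symm.trans (θε.trans (θP.trans (θV.prodCongr η.symm)))
  refine ⟨T, fun x ↦ ?_, η, fun b ↦ ?_⟩
  · -- `pr₁ ∘ T = q(ℂ)`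
    obtain ⟨Q, rfl⟩ := θO.surjective x
    change ((θV (AlgPoints.prodEquiv (AlgPoints.map φ.hom (θO.symm (θO Q)))).1 :
        ↥{P : ComplexPoints X | P.pt ∈ U}) : ComplexPoints X) = AlgPoints.map q ((θO Q).1)
    rw [θO.symm_apply_apply, AlgPoints.prodEquiv_apply_fst, hθV, hθO, ← AlgPoints.map_comp_apply,
      ← AlgPoints.map_comp_apply, hom_fst_ι φ hφ, AlgPoints.map_comp_apply]
  · -- the inverse on the fibre over `b` is the fibre embedding at `θV⁻¹ b`
    refine ⟨lift (toSpecOver (Motives.projectiveSpace r ℂ) ≫ θV.symm b) (𝟙 _) ≫ φ.inv ≫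
      openSubschemeOverι E (q.left ⁻¹ᵁ U), isClosedImmersion_fibre_left φ hφ (θV.symm b), fun v ↦ ?_⟩
    rw [map_fibre]
    rfl

end Triv

end ZariskiProjectiveBundle

end Literature.AlgebraicGeometry.HodgeTheory

end
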